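import Summits.FinalStateConjecture.FinalStateConjecture.Theses.SwallowTheDatum
import Summits.FinalStateConjecture.FinalStateConjecture.Theorems.SwallowTheDatumMGHDExists
import Literature.Geometry.Lorentzian.KerrDataProofs
import Literature.Geometry.Lorentzian.KerrSchildCoord

/-!
# Route SwallowTheDatum · target `UniversalWitnessFamily` (item stmt-FinalStateConjecture-10051):
# reduction to the route's cruxes

Pure logic. Through every admissible datum `d` the burial crux `ParametricKerrBurial` supplies a
jointly smooth injective admissible one-parameter family `F` with `F 0 = d` all of whose members
`F c`, `c ≠ 0`, are Kerr-shielded; MGHD existence for admissible data gives the `∃`-MGHD conjunct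
of the summit's conclusion `P (F c)`, and `KerrShieldedSettles` gives its `∀`-MGHD conjunct for
Kerr-shielded admissible data. The two cruxes are guarded by the instance binder
`∀ [Kerr.Facts]`; that instance is assembled from the theorems `Kerr.isConnected_region_holds`,
`Kerr.contMDiff_bilin_holds`, `Kerr.contMDiff_timeVector_holds`, so no hypothesis beyond the
displayed ones enters. Two forms are recorded:

* `universalWitnessFamily_of_burial_of_settles_of_mghd` — with MGHD existence on admissible data
  spelled out (verbatim the statement of the shared route decl `MGHDExists`,
  item stmt-FinalStateConjecture-9937, which it accepts by `exact`);
* `universalWitnessFamily_of_cruxes_of_choquetBruhatGeroch` — with the Literature named fact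
  `choquetBruhat_geroch_exists_mghd_cauchy` (Choquet-Bruhat–Geroch 1969, Thm. 3; undischarged) in
  its place, via `mghdExists_of_choquetBruhatGeroch` (`SwallowTheDatumMGHDExists.lean`). This is a
  CONDITIONAL result and displays exactly what the target still owes: the cruxes
  `ParametricKerrBurial` (stmt-FinalStateConjecture-10052), `KerrShieldedSettles`
  (stmt-FinalStateConjecture-10054) and the discharge theorem of the named fact.

(The same glue was first landed as `Theorems/SwallowTheDatumTargetGlue.lean` against the route's
bookkeeping decl `TargetGlue`, which revision 4 of the route file has since dropped; this file is
stated against the current route file only.)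
-/

namespace Summit.FinalStateConjecture.FinalStateConjecture.Theorems

open Literature.Geometry.Lorentzian
open scoped Manifold ContDiff

/-- **Glue of route SwallowTheDatum.**
`ParametricKerrBurial → KerrShieldedSettles → (∀ X, ∀ D ∈ admissibleVacuumData X, ∃ MGHD) →
UniversalWitnessFamily`: take the family `F` of the burial through the given admissible datum;
for `c ≠ 0` the `∃`-MGHD conjunct of the summit conclusion for `F c` is MGHD existence at the
admissible datum `F c`, and the `∀`-MGHD conjunct is `KerrShieldedSettles` at `F c`, whose
shielding hypothesis is exactly what the burial provides. The instance `Kerr.Facts` demanded by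
the two cruxes is assembled in the proof from the three `_holds` theorems. The third hypothesis
is, verbatim, the statement of the shared route decl `MGHDExists` (Choquet-Bruhat–Geroch 1969,
Thm. 3, on admissible data). -/
theorem SwallowTheDatum.universalWitnessFamily_of_burial_of_settles_of_mghd
    (hB : Summit.FinalStateConjecture.FinalStateConjecture.Theses.SwallowTheDatum.ParametricKerrBurial)
    (hS : Summit.FinalStateConjecture.FinalStateConjecture.Theses.SwallowTheDatum.KerrShieldedSettles)
    (hM : ∀ (X : Type) [TopologicalSpace X] [ChartedSpace E3 X] [IsManifold (𝓡 3) ∞ X] [T2Space X]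
      [SecondCountableTopology X] [ConnectedSpace X], ∀ D ∈ admissibleVacuumData X,
      ∃ 𝒟 : VacuumCauchyDevelopment D, 𝒟.IsMaximal) :
    Summit.FinalStateConjecture.FinalStateConjecture.Theses.SwallowTheDatum.UniversalWitnessFamily := by
  unfold Summit.FinalStateConjecture.FinalStateConjecture.Theses.SwallowTheDatum.UniversalWitnessFamily
  unfold Summit.FinalStateConjecture.FinalStateConjecture.Theses.SwallowTheDatum.ParametricKerrBurial
    at hB
  unfold Summit.FinalStateConjecture.FinalStateConjecture.Theses.SwallowTheDatum.KerrShieldedSettles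
    at hS
  intro X _ _ _ _ _ _ d hd
  haveI : Kerr.Facts :=
    ⟨Kerr.isConnected_region_holds, Kerr.contMDiff_bilin_holds, Kerr.contMDiff_timeVector_holds⟩
  obtain ⟨F, hF, h0, hinj, hadm, hshield⟩ := hB X d hd
  exact ⟨F, hF, h0, hinj, hadm, fun c hc ↦
    ⟨hM X (F c) (hadm c), hS X (F c) (hadm c) (hshield c hc)⟩⟩

/-- **The target modulo the two route-specific cruxes and the Choquet-Bruhat–Geroch named fact.**
`ParametricKerrBurial` and `KerrShieldedSettles` together with the (undischarged) Literature fact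
`choquetBruhat_geroch_exists_mghd_cauchy` (Choquet-Bruhat–Geroch 1969, Thm. 3: every vacuum datum
solving the constraints has a maximal vacuum Cauchy development) imply the target: the shared item
`MGHDExists` is that fact restricted to admissible data (`mghdExists_of_choquetBruhatGeroch`).
CONDITIONAL result (trust base: Choquet-Bruhat–Geroch 1969, Thm. 3); it records what the target
still owes — items stmt-FinalStateConjecture-10052, -10054 and the discharge theorem of the fact. -/
theorem SwallowTheDatum.universalWitnessFamily_of_cruxes_of_choquetBruhatGeroch
    (hB : Summit.FinalStateConjecture.FinalStateConjecture.Theses.SwallowTheDatum.ParametricKerrBurial)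
    (hS : Summit.FinalStateConjecture.FinalStateConjecture.Theses.SwallowTheDatum.KerrShieldedSettles)
    (hCBG : choquetBruhat_geroch_exists_mghd_cauchy) :
    Summit.FinalStateConjecture.FinalStateConjecture.Theses.SwallowTheDatum.UniversalWitnessFamily :=
  SwallowTheDatum.universalWitnessFamily_of_burial_of_settles_of_mghd hB hS
    (mghdExists_of_choquetBruhatGeroch hCBG)

end Summit.FinalStateConjecture.FinalStateConjecture.Theorems
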